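import Summits.QuantumFields.BalabanUV.T4Continuum.Support.ScalarBlockPlateauFunction
import Summits.QuantumFields.BalabanUV.T4Continuum.Support.ScalarAveragedCompression

/-!
# T⁴ programme, spine node NE2 (U1a), tier B support row B4.c (iii), supplier «B4c-SIGMA-PLATEAU», file 2 — THE `U = 1` COMPRESSIONS
# `Q′G′Q′*` AND `Q′G′²Q′*` ARE COERCIVE WITH A POLYNOMIAL-IN-`d` CONSTANT: `Q′G′Q′* ≥ σ₁`, `Q′G′²Q′* ≥ σ₁²`, `‖(Q′G′²Q′*)⁻¹‖ ≤ σ₁⁻²`,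
# `σ₁ = (d·C₁(d) + a′)⁻¹`, `C₁(d) = 3(d+2)((d+2)/(d+1))^{d+1} ≤ 9(d+2)` — versus leaf-09's `σ₀ = (36^d(4d + a′))⁻¹`

NE2 formalisation swarm `b2b-balaban-t4-ne2-formalise-*`, leaf 05 (gen 8), supplier item «B4c-SIGMA-PLATEAU» = the «σ₀ lever» of the
threshold census.  Row B4.b factorises the gauge term of [Balaban1985BackgroundPropagators] (3.26) through the projection (3.25) p.394 and
takes as its last `U = 1` datum `n₁ = sup_k ‖(Q′G′²Q′*)⁻¹‖`; leaf-09's `ScalarAveragedCompression` supplies `n₁ = σ₀⁻²` with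
`σ₀ = sigma0 d a′ = (36^d(4d + a′))⁻¹` from the variational bound at the parabola trial function of `ScalarBlockTrialFunction`, and that
`σ₀` enters ROOT B's explicit threshold to the FOURTH power (`GaugeTermThreshold.KG ∝ σ₀⁻⁴`; leaf-05-g7 memo
`t4/T4-NUM-NE2-D3-CT-THRESHOLD.md` §4, two engines: `etaStar(co=2, d=4, a=a′=1) ≈ 9.44·10⁻⁷⁹`, `σ₀⁻⁴ ≈ 6.65·10²⁹`).  THIS FILE replaces the
parabola by the PLATEAU trial function of `ScalarBlockPlateauFunction` (files 1a/1b) inside the SAME variational bound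
(`ScalarAveragedCompression.variational`, BY NAME) and proves, still WITHOUT Fourier analysis:

 * §1 `form_Scomp_ge_of_trial`: the variational bound at `g = t·ψ` for ANY trial `ψ` with `re⟨ψ, Q′ᴴφ⟩ = B·nsq φ` and
   `re⟨ψ, Δ′ψ⟩ ≤ E·nsq φ` gives `n^d·B²/E·nsq φ ≤ re⟨φ, Sφ⟩` (`S = Scomp = Q′G′Q′*`);
 * §2 THE PARAMETRIC COERCIVITY **`form_Scomp_ge_plateau`**: for `1 ≤ m ≤ n`,
   `nsq φ / (d·Φ_d(n,m) + a′) ≤ re⟨φ, Sφ⟩`, **`PhiP d n m = n(2m+2)/m² · (n/(n+1−m))^{d+1}`** (ramp width `m`: block weight `≥ (n+1−m)/n`,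
   energy coefficient `Ecoef = d·n²·S₂^{d−1}·(2m+2)/m² + a′·n^d·((S₁/n)^d)²`; the arithmetic core `plateau_ratio : (d·Φ + a′)⁻¹ ≤ n^d·B²/E` is
   stated separately so that the region twin `RegionScalarCompressionSharp` re-uses it);
 * §3 THE UNIFORM COERCIVITY **`form_Scomp_ge_sharp`**: `sigma1 d a′ · nsq φ ≤ re⟨φ, Sφ⟩` with **`sigma1 d a′ = (d·C1 d + a′)⁻¹`**,
   **`C1 d = 3(d+2)((d+2)/(d+1))^{d+1}`** (the width `m = n/(d+2) + 1`; `PhiP_le_C1`), UNIFORM in `n = η⁻¹` and in the torus; `C1_le`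
   (`C1 d ≤ 9(d+2)`, as `(1 + 1/(d+1))^{d+1} ≤ e < 3`) and **`sigma0_le_sigma1`** (every consumer of `σ₀` may use `σ₁`);
 * §4 `form_Kcomp_ge_of` / `opNorm_Kcomp_inv_le_of` (leaf-09's `K ≥ S² ≥ σ²`, `‖K⁻¹‖ ≤ σ⁻²` for ANY coercivity constant `σ` of `S`) and
   **`form_Kcomp_ge_sharp`** (`σ₁²·nsq φ ≤ re⟨φ, Kφ⟩`), **`opNorm_Kcomp_inv_le_sharp`** (`‖(Q′G′²Q′*)⁻¹‖ ≤ σ₁⁻²` — the datum `n₁` of row B4.b).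

NUMBERS (a′ = 1; exact rationals, `g8/num/sigma1_cert.py` of the leaf-05 folder): d = 4: `C1 4 = 18·(6/5)^5 = 44.79`, `σ₁ = 3125/562997 = 5.55·10⁻³` versus
`σ₀ = 3.50·10⁻⁸` (× 1.58·10⁵; `n₁ = σ⁻²` smaller by 2.5·10¹⁰; `σ⁻⁴` smaller by 6.3·10²⁰); d = 3: `σ₁ = 9.02·10⁻³` vs `1.65·10⁻⁶`.  For
comparison, the `n → ∞` infimum of the Fourier symbol of `Q′G′Q′*` ([Balaban1984PropagatorsII] (2.75)) at the corner `p′ = (π,…,π)` is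
`≈ 1.30·10⁻²` (d = 4), `≈ 1.98·10⁻²` (d = 3) (float, `g8/num/plateau_scan.py`): `σ₁` is within a factor `≈ 2.4` of it; no optimality is claimed.  IF the
`σ₀`-dependence of `etaStar` were re-instantiated with `σ₁` (NOT done here), gen 7's interval engine projects `etaStar(2, 4, 1, 1)` from
`9.44·10⁻⁷⁹` to `≈ 5.96·10⁻⁵⁸` (`KG` from `2.11·10⁵⁷` to `3.35·10³⁶`).

HONEST FRAMING (T4-DAG p. 1).  [folklore] finite-dimensional variational/positivity arguments about the cell's typed `U = 1` objects;
statements / constants OURS and still crude; nothing printed is a hypothesis; leaf-09's files are imported BY NAME and not edited; the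
downstream constants (`GaugeTermThreshold.KD/KG/KB4`, `NE2BalabanThreshold.etaStar`, the CT chain's `kappaCT/etaCT`) are NOT re-defined
here.  `U = 1`, FIXED FINITE torus, scalar layer; a SUPPORT input of rows B4.b/B4.c (it changes no binder of ROOT B — only the SIZE of its
explicit threshold), NOT B4, NOT [B9] (3.23)–(3.26) as printed; NE2 NOT proved; spine 0/9 unchanged; NOT infinite volume / mass gap / Clay /
summit progress.  HONEST DEPENDENCY: continuum YM on T⁴ ⇐ BetaPertH ∧ nine spine estimates (0/9 proved); BetaPertH ⇐ (D1) ∧ (D4) ∧ CAP+tail;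
G-an2-4 gates asym, D1 and NE2/3/4.  ABSOLUTE RULE kept; zero sorries.
-/

noncomputable section

open scoped BigOperators ComplexConjugate ComplexOrder Matrix Matrix.Norms.L2Operator
open Finset

namespace Summit.QuantumFields.BalabanUV.T4Continuum.ScalarAveragedCompressionSharp

open Literature.MathematicalPhysics.QuantumFieldTheory.Balaban1983to89.B5Prop11Plancherel
open Literature.MathematicalPhysics.QuantumFieldTheory.Balaban1983to89.B5Prop11Lower (nsq nsq_nonneg star_dotProduct_self
  norm_star_dotProduct_le)
open Literature.MathematicalPhysics.QuantumFieldTheory.Balaban1983to89.B5Block118 (QsOp)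
open Summit.QuantumFields.BalabanUV.T4Continuum.ScalarBlockPoincare
open Summit.QuantumFields.BalabanUV.T4Continuum.ScalarAveragedPropagator
open Summit.QuantumFields.BalabanUV.T4Continuum.ScalarBlockPlateauRamp
open Summit.QuantumFields.BalabanUV.T4Continuum.ScalarBlockPlateauFunction
open Summit.QuantumFields.BalabanUV.T4Continuum.ScalarAveragedCompression

variable {d : ℕ}

/-! ## §1 The variational bound at a general trial function -/

section Generic

variable (n : ℕ) [NeZero n] (M : Fin d → ℕ) [hM : ∀ μ, NeZero (M μ)] {a' : ℝ}

/-- the variational bound of `ScalarAveragedCompression.variational` at `g = t·ψ`, `h = Q′ᴴφ`, optimised in `t`: if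
`re⟨ψ, Q′ᴴφ⟩ = B·nsq φ` and `re⟨ψ, Δ′ψ⟩ ≤ E·nsq φ` with `E > 0`, then `n^d·(B²/E)·nsq φ ≤ re⟨φ, Sφ⟩`. [folklore] -/
theorem form_Scomp_ge_of_trial (ha' : 0 < a') (φ : Tor M → ℂ) (ψ : Tor (fine n M) → ℂ) {B E : ℝ} (hE : 0 < E)
    (hB : (star ψ ⬝ᵥ ((QsOp n M)ᴴ *ᵥ φ)).re = B * nsq φ) (hEψ : (star ψ ⬝ᵥ (DeltaPs n M a' *ᵥ ψ)).re ≤ E * nsq φ) :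
    (n : ℝ) ^ d * (B ^ 2 / E) * nsq φ ≤ (star φ ⬝ᵥ (Scomp n M a' *ᵥ φ)).re := by
  have hn : (0 : ℝ) ≤ (n : ℝ) ^ d := pow_nonneg (Nat.cast_nonneg _) d
  set h := (QsOp n M)ᴴ *ᵥ φ with hh
  set t : ℝ := B / E with ht
  have hv := variational n M ha' ((t : ℂ) • ψ) h
  have e3 : (star ((t : ℂ) • ψ) ⬝ᵥ h).re = t * (B * nsq φ) := by
    rw [star_smul, smul_dotProduct, smul_eq_mul, Complex.star_def, Complex.conj_ofReal, Complex.re_ofReal_mul, hB]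
  have e4 : (star ((t : ℂ) • ψ) ⬝ᵥ (DeltaPs n M a' *ᵥ ((t : ℂ) • ψ))).re = t ^ 2 * (star ψ ⬝ᵥ (DeltaPs n M a' *ᵥ ψ)).re := by
    rw [Matrix.mulVec_smul, star_smul, smul_dotProduct, dotProduct_smul, smul_eq_mul, smul_eq_mul, Complex.star_def,
      Complex.conj_ofReal, ← mul_assoc, ← Complex.ofReal_mul, Complex.re_ofReal_mul, sq]
  rw [e3, e4] at hv
  have e5 : (star φ ⬝ᵥ (Scomp n M a' *ᵥ φ)).re = (n : ℝ) ^ d * (star h ⬝ᵥ (Gps n M a' *ᵥ h)).re := by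
    rw [form_Scomp, ← hh, ← Complex.ofReal_natCast, ← Complex.ofReal_pow, Complex.re_ofReal_mul]
  rw [e5, mul_assoc]
  refine mul_le_mul_of_nonneg_left ?_ hn
  have k1 : 2 * (t * (B * nsq φ)) - t ^ 2 * (E * nsq φ) = B ^ 2 / E * nsq φ := by
    rw [ht]; field_simp; ring
  have k2 : t ^ 2 * (star ψ ⬝ᵥ (DeltaPs n M a' *ᵥ ψ)).re ≤ t ^ 2 * (E * nsq φ) := mul_le_mul_of_nonneg_left hEψ (sq_nonneg t)
  linarith

end Generic

/-! ## §2 The parametric coercivity from the plateau trial function of width `m` -/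

section Plateau

variable (n m : ℕ) [NeZero n] (M : Fin d → ℕ) [hM : ∀ μ, NeZero (M μ)] {a' : ℝ}

/-- `Φ_d(n, m) = n(2m+2)/m² · (n/(n+1−m))^{d+1}`. [folklore] -/
def PhiP (d n m : ℕ) : ℝ := (n : ℝ) * (2 * (m : ℝ) + 2) / (m : ℝ) ^ 2 * ((n : ℝ) / ((n : ℝ) + 1 - m)) ^ (d + 1)

omit [NeZero n] in
/-- `0 ≤ Φ_d(n, m)` for `m ≤ n`. [folklore] -/
theorem PhiP_nonneg (hmn : m ≤ n) : 0 ≤ PhiP d n m := by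
  have h : (0 : ℝ) ≤ (n : ℝ) + 1 - m := by
    have : (m : ℝ) ≤ n := by exact_mod_cast hmn
    linarith
  unfold PhiP
  positivity

/-- the ENERGY COEFFICIENT of the plateau trial function: `E = d·n²·S₂^{d−1}·(2m+2)/m² + a′·n^d·((S₁/n)^d)²`. [folklore] -/
def Ecoef (d n m : ℕ) (a' : ℝ) : ℝ :=
  d * ((n : ℝ) ^ 2 * (S2 n m) ^ (d - 1) * ((2 * (m : ℝ) + 2) / (m : ℝ) ^ 2)) + a' * ((n : ℝ) ^ d * (((S1 n m) / (n : ℝ)) ^ d) ^ 2)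

omit [NeZero n] in
/-- `0 < E` (`0 < a′`, `1 ≤ m ≤ n`). [folklore] -/
theorem Ecoef_pos (ha' : 0 < a') (hm : 1 ≤ m) (hmn : m ≤ n) : 0 < Ecoef d n m a' := by
  obtain ⟨hS2, -, -, hS1⟩ := S1_S2_bounds n m hm
  have hmn' : (m : ℝ) ≤ n := by exact_mod_cast hmn
  have hm1 : (1 : ℝ) ≤ m := by exact_mod_cast hm
  have hS1pos : 0 < S1 n m := by linarith
  have hn0 : (0 : ℝ) < n := by linarith
  unfold Ecoef; positivity

/-- `re⟨ψ_φ, Δ′ψ_φ⟩ ≤ E·nsq φ` for the plateau trial function (files 1a/1b: `dirichlet_trialP_le`, `nsq_PiS_trialP`). [folklore] -/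
theorem re_form_DeltaPs_trialP_le (hm : 1 ≤ m) (φ : Tor M → ℂ) :
    (star (trialP n m M φ) ⬝ᵥ (DeltaPs n M a' *ᵥ trialP n m M φ)).re ≤ Ecoef d n m a' * nsq φ := by
  rw [re_form_DeltaPs, nsq_PiS_trialP, Ecoef, add_mul]
  have h1 := dirichlet_trialP_le n m M hm φ
  have h2 : a' * ((n : ℝ) ^ d * (((S1 n m) / (n : ℝ)) ^ d) ^ 2 * nsq φ) = a' * ((n : ℝ) ^ d * (((S1 n m) / (n : ℝ)) ^ d) ^ 2) * nsq φ := by ring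
  rw [h2]; linarith [h1]

omit [NeZero n] in
/-- THE ARITHMETIC OF THE PLATEAU: `1/(d·Φ_d(n,m) + a′) ≤ n^d·B²/E` with `B = (S₁/n)^d` — from `S₂ ≤ S₁` and `S₁ ≥ n + 1 − m` (the ratio
`B²/E` is increasing in `S₁`). [folklore] -/
theorem plateau_ratio (ha' : 0 < a') (hm : 1 ≤ m) (hmn : m ≤ n) :
    (d * PhiP d n m + a')⁻¹ ≤ (n : ℝ) ^ d * ((((S1 n m) / (n : ℝ)) ^ d) ^ 2 / Ecoef d n m a') := by
  have hm0 : (0 : ℝ) < m := by exact_mod_cast hm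
  have hmn' : (m : ℝ) ≤ n := by exact_mod_cast hmn
  have hn0 : (0 : ℝ) < n := by linarith [(show (1 : ℝ) ≤ m by exact_mod_cast hm)]
  obtain ⟨hS2, hS21, hS1n, hS1⟩ := S1_S2_bounds n m hm
  have hE0 := Ecoef_pos (d := d) n m ha' hm hmn
  set S₁ := S1 n m with hS₁
  set S₂ := S2 n m with hS₂
  have hden : 0 < (n : ℝ) + 1 - m := by linarith
  have hS1pos : 0 < S₁ := lt_of_lt_of_le hden hS1
  set β : ℝ := S₁ / n with hβ
  have hβ0 : 0 < β := div_pos hS1pos hn0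
  set B : ℝ := β ^ d with hB
  have hB0 : 0 < B := pow_pos hβ0 d
  set c : ℝ := (2 * (m : ℝ) + 2) / (m : ℝ) ^ 2 with hc
  have hc0 : 0 ≤ c := by positivity
  set E : ℝ := Ecoef d n m a' with hE
  have hEdef : E = d * ((n : ℝ) ^ 2 * S₂ ^ (d - 1) * c) + a' * ((n : ℝ) ^ d * B ^ 2) := by rw [hE, Ecoef]
  have hΦ := PhiP_nonneg (d := d) n m hmn
  have hkey : (d : ℝ) * ((n : ℝ) ^ 2 * S₂ ^ (d - 1) * c) ≤ (d : ℝ) * (PhiP d n m * ((n : ℝ) ^ d * B ^ 2)) := by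
    rcases Nat.eq_zero_or_pos d with hd | hd
    · -- `d = 0`: there is no direction and both sides vanish
      subst hd; simp
    · obtain ⟨k, rfl⟩ : ∃ k, d = k + 1 := ⟨d - 1, (Nat.sub_add_cancel hd).symm⟩
      refine mul_le_mul_of_nonneg_left ?_ (Nat.cast_nonneg _)
      rw [Nat.add_sub_cancel]
      set ρ : ℝ := (n : ℝ) / ((n : ℝ) + 1 - m) with hρ
      have hρβ : 1 ≤ ρ * β := by
        rw [hρ, hβ, div_mul_div_comm, mul_comm (n : ℝ) S₁, mul_div_mul_right _ _ hn0.ne', le_div_iff₀ hden, one_mul]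
        exact hS1
      have hS2β : S₂ ^ k ≤ ((n : ℝ) * β) ^ k := by
        refine pow_le_pow_left₀ hS2 ?_ k
        rw [hβ, mul_div_cancel₀ _ hn0.ne']
        exact hS21
      have hρβk : 1 ≤ (ρ * β) ^ (k + 2) := one_le_pow₀ hρβ
      have hnb : 0 ≤ (n : ℝ) ^ (k + 2) * β ^ k * c := by positivity
      calc (n : ℝ) ^ 2 * S₂ ^ k * c ≤ (n : ℝ) ^ 2 * ((n : ℝ) * β) ^ k * c := by gcongr
        _ = (n : ℝ) ^ (k + 2) * β ^ k * c * 1 := by ring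
        _ ≤ (n : ℝ) ^ (k + 2) * β ^ k * c * (ρ * β) ^ (k + 2) := mul_le_mul_of_nonneg_left hρβk hnb
        _ = PhiP (k + 1) n m * ((n : ℝ) ^ (k + 1) * B ^ 2) := by
            rw [hB, PhiP, ← hρ, hc]; ring
  have hEle : E ≤ (d * PhiP d n m + a') * ((n : ℝ) ^ d * B ^ 2) := by
    rw [hEdef, add_mul]; linarith [hkey]
  have hpos : 0 < d * PhiP d n m + a' := by positivity
  rw [inv_le_iff_one_le_mul₀ hpos]
  have e : (n : ℝ) ^ d * (B ^ 2 / E) * (d * PhiP d n m + a') = ((d * PhiP d n m + a') * ((n : ℝ) ^ d * B ^ 2)) / E := by field_simp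
  rw [e, le_div_iff₀ hE0, one_mul]; exact hEle

/-- **THE PARAMETRIC COERCIVITY OF `S = Q′G′Q′*`**: `nsq φ / (d·Φ_d(n,m) + a′) ≤ re⟨φ, Sφ⟩` for every ramp width `1 ≤ m ≤ n`. [folklore] -/
theorem form_Scomp_ge_plateau (ha' : 0 < a') (hm : 1 ≤ m) (hmn : m ≤ n) (φ : Tor M → ℂ) :
    nsq φ / (d * PhiP d n m + a') ≤ (star φ ⬝ᵥ (Scomp n M a' *ᵥ φ)).re := by
  have hgen := form_Scomp_ge_of_trial n M ha' φ (trialP n m M φ) (Ecoef_pos (d := d) n m ha' hm hmn) (re_trialP_dot n m M φ)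
    (re_form_DeltaPs_trialP_le n m M hm φ)
  refine le_trans ?_ hgen
  rw [div_eq_mul_inv, mul_comm]
  exact mul_le_mul_of_nonneg_right (plateau_ratio (d := d) n m ha' hm hmn) (nsq_nonneg φ)

end Plateau

/-! ## §3 The uniform constant `σ₁ = (d·C₁(d) + a′)⁻¹` -/

section Uniform

variable (n : ℕ) [NeZero n] (M : Fin d → ℕ) [hM : ∀ μ, NeZero (M μ)] {a' : ℝ}

/-- `C₁(d) = 3(d+2)·((d+2)/(d+1))^{d+1}`. [folklore] -/
def C1 (d : ℕ) : ℝ := 3 * ((d : ℝ) + 2) * (((d : ℝ) + 2) / ((d : ℝ) + 1)) ^ (d + 1)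

/-- the uniform coercivity constant `σ₁ = (d·C₁(d) + a′)⁻¹`. [folklore] -/
def sigma1 (d : ℕ) (a' : ℝ) : ℝ := ((d : ℝ) * C1 d + a')⁻¹

omit [NeZero n] hM in
/-- `2 ≤ ((d+2)/(d+1))^{d+1}` (Bernoulli) and hence `6(d+2) ≤ C₁(d)`, `0 < C₁(d)`. [folklore] -/
theorem C1_ge : 2 ≤ (((d : ℝ) + 2) / ((d : ℝ) + 1)) ^ (d + 1) ∧ 6 * ((d : ℝ) + 2) ≤ C1 d ∧ 0 < C1 d := by
  have hd1 : (0 : ℝ) < (d : ℝ) + 1 := by positivity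
  have h2 : 2 ≤ (((d : ℝ) + 2) / ((d : ℝ) + 1)) ^ (d + 1) := by
    have e : ((d : ℝ) + 2) / ((d : ℝ) + 1) = 1 + 1 / ((d : ℝ) + 1) := by field_simp; ring
    have hb := one_add_mul_le_pow (a := 1 / ((d : ℝ) + 1)) (by rw [one_div]; linarith [inv_pos.mpr hd1]) (d + 1)
    have e2 : (1 : ℝ) + ((d + 1 : ℕ) : ℝ) * (1 / ((d : ℝ) + 1)) = 2 := by push_cast; field_simp; ring
    rw [e, ← e2]; exact hb
  exact ⟨h2, by unfold C1; nlinarith [h2], by unfold C1; positivity⟩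

omit [NeZero n] hM in
/-- `0 < σ₁`. [folklore] -/
theorem sigma1_pos (ha' : 0 < a') : 0 < sigma1 d a' := by
  have := (C1_ge (d := d)).2.2; unfold sigma1; positivity

omit [NeZero n] hM in
/-- the WIDTH CHOICE `m = n/(d+2) + 1` (integer division): `1 ≤ m ≤ n` and `Φ_d(n, m) ≤ C₁(d)`. [folklore] -/
theorem PhiP_le_C1 (hn : 1 ≤ n) : 1 ≤ n / (d + 2) + 1 ∧ n / (d + 2) + 1 ≤ n ∧ PhiP d n (n / (d + 2) + 1) ≤ C1 d := by
  obtain ⟨q, hq⟩ : ∃ q : ℕ, n / (d + 2) = q := ⟨_, rfl⟩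
  have hq1 : q * (d + 2) ≤ n := by rw [← hq]; exact Nat.div_mul_le_self n (d + 2)
  have hq2 : n < q * (d + 2) + (d + 2) := by rw [← hq]; exact Nat.lt_div_mul_add (by positivity)
  have hqn : q + 1 ≤ n := by
    have : q * 2 ≤ q * (d + 2) := Nat.mul_le_mul_left q (by omega)
    omega
  rw [hq]
  refine ⟨by omega, hqn, ?_⟩
  have hn0 : (0 : ℝ) < n := by exact_mod_cast hn
  have hq1' : (q : ℝ) * ((d : ℝ) + 2) ≤ n := by exact_mod_cast hq1
  have hq2' : (n : ℝ) < ((q : ℝ) + 1) * ((d : ℝ) + 2) := by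
    have : (n : ℝ) < (q : ℝ) * ((d : ℝ) + 2) + ((d : ℝ) + 2) := by exact_mod_cast hq2
    linarith
  have hd1 : (0 : ℝ) < (d : ℝ) + 1 := by positivity
  have hd2 : (0 : ℝ) < (d : ℝ) + 2 := by positivity
  have hm0 : (0 : ℝ) < (q : ℝ) + 1 := by positivity
  -- the density ratio `ρ = n/(n+1−m) = n/(n−q) ≤ (d+2)/(d+1)`
  have hden : 0 < (n : ℝ) - q := by nlinarith
  have hρ : (n : ℝ) / ((n : ℝ) - q) ≤ ((d : ℝ) + 2) / ((d : ℝ) + 1) := by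
    rw [div_le_div_iff₀ hden hd1]; nlinarith
  have hρ0 : 0 ≤ (n : ℝ) / ((n : ℝ) - q) := by positivity
  have hρpow : ((n : ℝ) / ((n : ℝ) - q)) ^ (d + 1) ≤ (((d : ℝ) + 2) / ((d : ℝ) + 1)) ^ (d + 1) := pow_le_pow_left₀ hρ0 hρ _
  obtain ⟨h2, hC6, hC0⟩ := C1_ge (d := d)
  have em : (((q + 1 : ℕ)) : ℝ) = (q : ℝ) + 1 := by push_cast; ring
  unfold PhiP
  rw [em, show (n : ℝ) + 1 - ((q : ℝ) + 1) = (n : ℝ) - q by ring]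
  rcases Nat.eq_zero_or_pos q with hq0 | hq0
  · -- `m = 1`: `Φ = 4n ≤ 4(d+1) ≤ 6(d+2) ≤ C₁`
    have hq0' : (q : ℝ) = 0 := by exact_mod_cast hq0
    rw [hq0', zero_add, sub_zero, div_self hn0.ne', one_pow, one_pow, mul_one, div_one]
    have : (n : ℝ) < (d : ℝ) + 2 := by rw [hq0'] at hq2'; linarith
    nlinarith
  · -- `m ≥ 2`: `n(2m+2)/m² < 3(d+2)` and `ρ^{d+1} ≤ ((d+2)/(d+1))^{d+1}`
    have hq0' : (1 : ℝ) ≤ q := by exact_mod_cast hq0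
    have hA : (n : ℝ) * (2 * ((q : ℝ) + 1) + 2) / ((q : ℝ) + 1) ^ 2 ≤ 3 * ((d : ℝ) + 2) := by
      rw [div_le_iff₀ (by positivity)]
      nlinarith [mul_pos hm0 hd2]
    have hA0 : 0 ≤ (n : ℝ) * (2 * ((q : ℝ) + 1) + 2) / ((q : ℝ) + 1) ^ 2 := by positivity
    calc (n : ℝ) * (2 * ((q : ℝ) + 1) + 2) / ((q : ℝ) + 1) ^ 2 * ((n : ℝ) / ((n : ℝ) - q)) ^ (d + 1)
        ≤ 3 * ((d : ℝ) + 2) * (((d : ℝ) + 2) / ((d : ℝ) + 1)) ^ (d + 1) := mul_le_mul hA hρpow (by positivity) (by positivity)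
      _ = C1 d := rfl

/-- **`S = Q′G′Q′*` IS COERCIVE WITH A POLYNOMIAL-IN-`d` CONSTANT, UNIFORMLY IN `η` AND IN THE TORUS**: `σ₁·nsq φ ≤ re⟨φ, Sφ⟩`,
`σ₁ = (d·C₁(d) + a′)⁻¹`. [folklore] -/
theorem form_Scomp_ge_sharp (ha' : 0 < a') (φ : Tor M → ℂ) : sigma1 d a' * nsq φ ≤ (star φ ⬝ᵥ (Scomp n M a' *ᵥ φ)).re := by
  have hn : 1 ≤ n := Nat.pos_of_ne_zero (NeZero.ne n)
  obtain ⟨hm, hmn, hΦ⟩ := PhiP_le_C1 (d := d) (n := n) hn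
  refine le_trans ?_ (form_Scomp_ge_plateau n (n / (d + 2) + 1) M ha' hm hmn φ)
  rw [div_eq_mul_inv, mul_comm (nsq φ)]
  refine mul_le_mul_of_nonneg_right ?_ (nsq_nonneg φ)
  have hpos : 0 < (d : ℝ) * PhiP d n (n / (d + 2) + 1) + a' := by
    have := PhiP_nonneg (d := d) n (n / (d + 2) + 1) hmn
    positivity
  unfold sigma1
  exact inv_anti₀ hpos (by nlinarith [hΦ, (Nat.cast_nonneg d : (0 : ℝ) ≤ d)])

omit [NeZero n] hM in
/-- `C₁(d) ≤ 9(d+2)`, since `(1 + 1/(d+1))^{d+1} ≤ e < 3`. [folklore] -/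
theorem C1_le : C1 d ≤ 9 * ((d : ℝ) + 2) := by
  have hd1 : (0 : ℝ) < (d : ℝ) + 1 := by positivity
  have hρ0 : (0 : ℝ) ≤ ((d : ℝ) + 2) / ((d : ℝ) + 1) := by positivity
  have h1 : ((d : ℝ) + 2) / ((d : ℝ) + 1) ≤ Real.exp (1 / ((d : ℝ) + 1)) := by
    have e : ((d : ℝ) + 2) / ((d : ℝ) + 1) = 1 / ((d : ℝ) + 1) + 1 := by field_simp; ring
    rw [e]; exact Real.add_one_le_exp _
  have h2 : (((d : ℝ) + 2) / ((d : ℝ) + 1)) ^ (d + 1) ≤ 3 := by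
    calc (((d : ℝ) + 2) / ((d : ℝ) + 1)) ^ (d + 1) ≤ (Real.exp (1 / ((d : ℝ) + 1))) ^ (d + 1) := pow_le_pow_left₀ hρ0 h1 _
      _ = Real.exp 1 := by
          rw [← Real.exp_nat_mul]; congr 1; push_cast; field_simp
      _ ≤ 3 := by have := Real.exp_one_lt_d9; linarith
  unfold C1
  nlinarith [h2]

omit [NeZero n] hM in
/-- **`σ₀ ≤ σ₁`**: leaf-09's constant `σ₀ = (36^d(4d + a′))⁻¹` is dominated, so every consumer of `σ₀` may use `σ₁` instead (`0 < a′`). [folklore] -/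
theorem sigma0_le_sigma1 (ha' : 0 < a') : sigma0 d a' ≤ sigma1 d a' := by
  have hC := C1_le (d := d)
  have hC0 := (C1_ge (d := d)).2.2
  have h36 : (1 : ℝ) + (d : ℕ) * 35 ≤ (36 : ℝ) ^ d := by
    have := one_add_mul_le_pow (a := (35 : ℝ)) (by norm_num) d
    norm_num at this ⊢; exact this
  have h36' : (1 : ℝ) ≤ (36 : ℝ) ^ d := one_le_pow₀ (by norm_num)
  unfold sigma0 sigma1
  refine inv_anti₀ (by positivity) ?_
  -- `d·C₁ + a′ ≤ 9d(d+2) + a′ ≤ 36^d·4d + 36^d·a′`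
  have hd0 : (0 : ℝ) ≤ d := Nat.cast_nonneg d
  have step1 : (d : ℝ) * C1 d ≤ (d : ℝ) * (9 * ((d : ℝ) + 2)) := mul_le_mul_of_nonneg_left hC hd0
  have step2 : (d : ℝ) * (9 * ((d : ℝ) + 2)) ≤ (36 : ℝ) ^ d * (4 * d) := by
    rcases Nat.eq_zero_or_pos d with hd | hd
    · subst hd; simp
    · have hd1 : (1 : ℝ) ≤ d := by exact_mod_cast hd
      have h4 : 4 * (d : ℝ) * (1 + (d : ℝ) * 35) ≤ 4 * (d : ℝ) * (36 : ℝ) ^ d :=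
        mul_le_mul_of_nonneg_left (by exact_mod_cast h36) (by positivity)
      nlinarith [h4, hd1]
  have step3 : a' ≤ (36 : ℝ) ^ d * a' := le_mul_of_one_le_left ha'.le h36'
  nlinarith [step1, step2, step3]

end Uniform

/-! ## §4 `K = Q′G′²Q′* ≥ S² ≥ σ²` and `‖K⁻¹‖ ≤ σ⁻²` for ANY coercivity constant `σ` of `S`; the sharp instances -/

section Kbound

variable (n : ℕ) [NeZero n] (M : Fin d → ℕ) [hM : ∀ μ, NeZero (M μ)] {a' : ℝ}

/-- `σ·nsq ≤ re⟨·, S·⟩` for all vectors implies `σ²·nsq φ ≤ re⟨φ, Kφ⟩` (leaf-09's Cauchy–Schwarz step, with `σ` abstract). [folklore] -/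
theorem form_Kcomp_ge_of {σ : ℝ} (hσ : 0 < σ) (hS : ∀ φ : Tor M → ℂ, σ * nsq φ ≤ (star φ ⬝ᵥ (Scomp n M a' *ᵥ φ)).re)
    (φ : Tor M → ℂ) : σ ^ 2 * nsq φ ≤ (star φ ⬝ᵥ (Kcomp n M a' *ᵥ φ)).re := by
  refine le_trans ?_ (nsq_Scomp_le_form_Kcomp n M φ)
  have h1 : σ * nsq φ ≤ Real.sqrt (nsq φ) * Real.sqrt (nsq (Scomp n M a' *ᵥ φ)) := (hS φ).trans (re_star_dotProduct_le _ _)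
  have hsφ : Real.sqrt (nsq φ) ^ 2 = nsq φ := Real.sq_sqrt (nsq_nonneg _)
  have hsS : Real.sqrt (nsq (Scomp n M a' *ᵥ φ)) ^ 2 = nsq (Scomp n M a' *ᵥ φ) := Real.sq_sqrt (nsq_nonneg _)
  by_cases hz : nsq φ = 0
  · rw [hz, mul_zero]; exact nsq_nonneg _
  · have hpos : 0 < nsq φ := lt_of_le_of_ne (nsq_nonneg _) (Ne.symm hz)
    have hsq0 : 0 < Real.sqrt (nsq φ) := Real.sqrt_pos.mpr hpos
    have h2 : σ * Real.sqrt (nsq φ) ≤ Real.sqrt (nsq (Scomp n M a' *ᵥ φ)) := by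
      have h3 : σ * Real.sqrt (nsq φ) * Real.sqrt (nsq φ) ≤ Real.sqrt (nsq (Scomp n M a' *ᵥ φ)) * Real.sqrt (nsq φ) := by
        rw [mul_assoc, ← sq, hsφ, mul_comm (Real.sqrt _)]; exact h1
      exact le_of_mul_le_mul_right h3 hsq0
    calc σ ^ 2 * nsq φ = (σ * Real.sqrt (nsq φ)) ^ 2 := by rw [mul_pow, hsφ]
      _ ≤ Real.sqrt (nsq (Scomp n M a' *ᵥ φ)) ^ 2 := pow_le_pow_left₀ (mul_nonneg hσ.le (Real.sqrt_nonneg _)) h2 2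
      _ = nsq (Scomp n M a' *ᵥ φ) := hsS

/-- … and `‖K⁻¹‖ ≤ σ⁻²` (leaf-09's `opNorm_Kcomp_inv_le`, with `σ` abstract). [folklore] -/
theorem opNorm_Kcomp_inv_le_of (ha' : 0 < a') {σ : ℝ} (hσ : 0 < σ)
    (hS : ∀ φ : Tor M → ℂ, σ * nsq φ ≤ (star φ ⬝ᵥ (Scomp n M a' *ᵥ φ)).re) : ‖(Kcomp n M a')⁻¹‖ ≤ (σ ^ 2)⁻¹ := by
  have hσ2 : 0 < σ ^ 2 := pow_pos hσ 2
  refine opNorm_le_of_nsq_le_rect _ (inv_nonneg.mpr hσ2.le) fun y => ?_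
  set x := (Kcomp n M a')⁻¹ *ᵥ y with hx
  have hKx : Kcomp n M a' *ᵥ x = y := by
    rw [hx, Matrix.mulVec_mulVec, Matrix.mul_nonsing_inv _ (isUnit_det_Kcomp n M ha'), Matrix.one_mulVec]
  have h1 : σ ^ 2 * nsq x ≤ (star x ⬝ᵥ y).re := by
    have h := form_Kcomp_ge_of n M hσ hS x
    rwa [hKx] at h
  have h2 : (star x ⬝ᵥ y).re ≤ Real.sqrt (nsq x) * Real.sqrt (nsq y) := re_star_dotProduct_le x y
  have hsx : Real.sqrt (nsq x) ^ 2 = nsq x := Real.sq_sqrt (nsq_nonneg _)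
  have hsy : Real.sqrt (nsq y) ^ 2 = nsq y := Real.sq_sqrt (nsq_nonneg _)
  have h3 : σ ^ 2 * Real.sqrt (nsq x) ≤ Real.sqrt (nsq y) := by
    by_cases hz : Real.sqrt (nsq x) = 0
    · rw [hz, mul_zero]; exact Real.sqrt_nonneg _
    · have hpos : 0 < Real.sqrt (nsq x) := lt_of_le_of_ne (Real.sqrt_nonneg _) (Ne.symm hz)
      have h4 : σ ^ 2 * Real.sqrt (nsq x) * Real.sqrt (nsq x) ≤ Real.sqrt (nsq y) * Real.sqrt (nsq x) := by
        nlinarith [h1, h2, hsx]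
      exact le_of_mul_le_mul_right h4 hpos
  have h5 : Real.sqrt (nsq x) ≤ (σ ^ 2)⁻¹ * Real.sqrt (nsq y) := by
    rw [← div_eq_inv_mul, le_div_iff₀ hσ2]; linarith
  calc nsq x = Real.sqrt (nsq x) ^ 2 := hsx.symm
    _ ≤ ((σ ^ 2)⁻¹ * Real.sqrt (nsq y)) ^ 2 := pow_le_pow_left₀ (Real.sqrt_nonneg _) h5 2
    _ = ((σ ^ 2)⁻¹) ^ 2 * nsq y := by rw [mul_pow, hsy]

/-- **`K = Q′G′²Q′*` IS COERCIVE with the sharp constant**: `σ₁²·nsq φ ≤ re⟨φ, Kφ⟩`. [folklore] -/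
theorem form_Kcomp_ge_sharp (ha' : 0 < a') (φ : Tor M → ℂ) : (sigma1 d a') ^ 2 * nsq φ ≤ (star φ ⬝ᵥ (Kcomp n M a' *ᵥ φ)).re :=
  form_Kcomp_ge_of n M (sigma1_pos (d := d) ha') (fun φ => form_Scomp_ge_sharp n M ha' φ) φ

/-- **`‖(Q′G′²Q′*)⁻¹‖ ≤ σ₁⁻²` — row B4.b's datum `n₁` with the polynomial-in-`d` constant, UNIFORM in `η = 1/n` and in the torus.** [folklore] -/
theorem opNorm_Kcomp_inv_le_sharp (ha' : 0 < a') : ‖(Kcomp n M a')⁻¹‖ ≤ ((sigma1 d a') ^ 2)⁻¹ :=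
  opNorm_Kcomp_inv_le_of n M ha' (sigma1_pos (d := d) ha') fun φ => form_Scomp_ge_sharp n M ha' φ

/-- kernel sanity check of the constants: `C₁(4) = 18·(6/5)^5` and `σ₁(4, 1) = (72·(6/5)^5 + 1)⁻¹` (`≈ 1/180.2`). [folklore] -/
example : C1 4 = 18 * (6 / 5 : ℝ) ^ 5 ∧ sigma1 4 1 = (72 * (6 / 5 : ℝ) ^ 5 + 1)⁻¹ := by
  unfold sigma1 C1; norm_num

end Kbound

end Summit.QuantumFields.BalabanUV.T4Continuum.ScalarAveragedCompressionSharp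

end
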